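import Summits.QuantumFields.YangMills.Theorems.GrossTransferStubLinTestBianchiTerm
import Summits.QuantumFields.YangMills.Theorems.CovariantDischargeGreenPotentialShell
import Summits.QuantumFields.YangMills.Theorems.CovariantDischargeTruncatedPotentialPairing
import Literature.MathematicalPhysics.QuantumFieldTheory.Balaban1983to89.T3ContinuumYM3Torus
import HarnessLib

/-!
# `GrossTransferStubLinTestPointwiseMasses` — R8-P8 OF `stub_linTest`'s POINTWISE PACKAGE, PART (I-b): THE `ℓ¹` MASSES AND THE BIANCHI ROW IN NUMBERS
# (LINE 28 «GrossTransfer» v3.2, skeleton of record `Cruxes/HistoryTailL/Lines/gross_transfer.lean`; crux `RevelationMartingale.MeanDeviationL`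
# stmt-QuantumFields-23083 ∕ `UnitScaleTilt.HistoryTailL` stmt-QuantumFields-19936)

Cell `ym3-torus` (YM ladder rung R3 = continuum SU(2) Yang–Mills on T³ — a RUNG, NOT the Clay problem: not d = 4, not infinite volume, not a
mass gap); width seat `ym3-torus-px13` (gen 12), pen on `main_estimate`, helper `--supports stmt-QuantumFields-23083`; part (I-b) of the ≤ 400-line
split of the pen's `main_estimate` (ym-ust-19936-w2 g16's plan W∕Q∕I∕P∕MAIN).  THEOREMS ONLY (0 `def`, 0 `sorry`, default heartbeats).  The letters
are the T³ member's (`Zd (F.P K).d`, `(F.P K).d = 3` by `rfl`), so that the `ℤ³` Green-kernel rows of ✓(Z-e) `CovariantDischargeGreenPotentialShell`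
(`near_mass_le`, `bulk_mass_le`) apply verbatim.

WHAT.  With `M₀ := Σ_μΣ_νΣ_{Q_{ℓ0}}|wt|`, `K₀ := Σ_e|G(e) − G(0)|`, the kernel row `|∇G(w)| ≤ C₁∕n²` off `Q_{n−1}(0)`:
* §1 ★`aR_mass_le` — `Σ_{B}Σ_ν|aR| ≤ (9∕2)(K₀ + 26C₁(3R+1+ℓ0))·M₀` for EVERY finite `B` (✓`sum_abs_truncated_le` + ✓`near_mass_le`);
* §2 ★★`bianchi_abs_le` — the Bianchi term of (P4) in numbers: `|Σ_{Q_{3R+2}}ΣΣΣ(χγt)·∇F̂^α| ≤ 1312·((d−1)nθ)²·(81∕2)(K₀ + 26C₁(3R+ℓ0))·M₀`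
  (✓px13 `bianchi_term_le_of_letters` + ✓`bulk_mass_le`);
* §3 ★★`sigma_abs_mass_le` — the `ℓ¹` mass of the collar 2-form `σ = E₁ − C₂` on `Q_{3R+2}`: `Σ_{Q_{3R+2}}ΣΣ|σ| ≤ 6·near(3R+3) + bulk(3R+3)`
  (`|χ − χ| ≤ 1`, unit-shift re-indexing `Σ_{Q_S} f(·+v) ≤ Σ_{Q_{S+1}} f`, ✓`near_mass_le`∕✓`bulk_mass_le` at `S = 3R+3`).

HONEST SCOPE.  Finite-sum bookkeeping about ONE configuration; proves no stub: `stub_linTest`, its pointwise package, `MeanDeviationL` 23083, `HistoryTailL`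
19936, the rung `YM3TorusSU2` are NOT proved; no summit statement is proved; the Yang–Mills mass gap is NOT proved.
References: [GrossCMP1983] Thm 2.2; [Balaban1984PropagatorsII] (1.9) p. 226 (lattice Green kernel rows).
-/

noncomputable section

set_option autoImplicit false

open scoped BigOperators Matrix.Norms.L2Operator
open Complex Finset
open Literature.Probability.LatticeModels (latticeGreen)
open Literature.MathematicalPhysics.QuantumFieldTheory.Balaban1983to89
open Literature.MathematicalPhysics.QuantumFieldTheory.Balaban1983to89.T3ContinuumYM3Torus
open Literature.MathematicalPhysics.QuantumFieldTheory.Balaban1983to89.B4Eq19LatticeOperators (Zd unitVec box mem_box box_mono abs_unitVec_apply_le)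
open Literature.MathematicalPhysics.QuantumFieldTheory.Balaban1983to89.T4AxialGaugeSmallField (castSite boxPlaqs axialGauge)
open Literature.MathematicalPhysics.QuantumFieldTheory.Balaban1983to89.B10Eq18SigmaSU2 (pauli)

namespace Summit.QuantumFields.YangMills.Theorems.GrossTransferStubLinTestPointwiseMasses

variable (F : T3Family) (K : ℕ) {C₁ : ℝ} (hC₁ : 0 ≤ C₁)
  (hK1 : ∀ (e : Fin 3) (w : Zd 3) (m : ℕ), 1 ≤ m → w ∉ box (0 : Zd 3) ((m : ℤ) - 1) →
    |latticeGreen (w + unitVec e) - latticeGreen w| ≤ C₁ / (m : ℝ) ^ 2)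
  (wt βt : Zd (F.P K).d → Fin (F.P K).d → Fin (F.P K).d → ℝ) (at' : Zd (F.P K).d → Fin (F.P K).d → ℝ)
  (γt : Zd (F.P K).d → Fin (F.P K).d → Fin (F.P K).d → Fin (F.P K).d → ℝ) (z₀ : Zd (F.P K).d) (ℓ0 : ℕ)
  (hβt : ∀ x μ ν, βt x μ ν = ∑ y ∈ box z₀ (ℓ0 : ℤ), latticeGreen (x - y) / 2 * wt y μ ν)
  (hat : ∀ x ν, at' x ν = ∑ μ, (βt (x - unitVec μ) μ ν - βt x μ ν))
  (hγt : ∀ x κ μ ν, γt x κ μ ν =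
    (βt (x + unitVec κ) μ ν - βt x μ ν) - (βt (x + unitVec μ) κ ν - βt x κ ν) + (βt (x + unitVec ν) κ μ - βt x κ μ))
  (χ : Zd (F.P K).d → ℝ) (R : ℕ) (hχ01 : ∀ x, 0 ≤ χ x ∧ χ x ≤ 1) (hχ0 : ∀ x, x ∉ box z₀ (3 * (R : ℤ)) → χ x = 0)

/-! ## §1 The `ℓ¹` mass of the truncated potential -/

include hC₁ hK1 hβt hat hχ01 hχ0 in
/-- ★ **THE `ℓ¹` MASS OF `aR = χ·at'`** on every finite set: `Σ_{B}Σ_ν|aR| ≤ (9∕2)·(K₀ + 26·C₁·(3R+1+ℓ0))·M₀`.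
[cite: Balaban1984PropagatorsII, (1.9) p.226] -/
theorem aR_mass_le (aR : Zd (F.P K).d → Fin (F.P K).d → ℝ) (haR : ∀ x ν, aR x ν = χ x * at' x ν) (B : Finset (Zd (F.P K).d)) :
    ∑ y ∈ B, ∑ ν, |aR y ν|
      ≤ (9 / 2) * ((∑ e' : Fin 3, |latticeGreen (unitVec e') - latticeGreen (0 : Zd 3)|) + 26 * C₁ * (((3 * R : ℕ) : ℝ) + 1 + ℓ0))
          * ∑ μ, ∑ ν, ∑ y ∈ box z₀ (ℓ0 : ℤ), |wt y μ ν| := by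
  have e3R : ((3 * R : ℕ) : ℤ) = 3 * (R : ℤ) := by push_cast; ring
  have hnear := CovariantDischargeGreenPotentialShell.near_mass_le hC₁ hK1 wt βt at' z₀ ℓ0 (3 * R) hβt hat
  rw [e3R] at hnear
  exact (CovariantDischargeTruncatedPotentialPairing.sum_abs_truncated_le at' χ aR z₀ (3 * (R : ℤ)) hχ01 hχ0 haR B).trans hnear

/-! ## §2 The Bianchi row in numbers -/

include hC₁ hK1 hβt hγt hχ01 hχ0 in
/-- ★★ **THE BIANCHI TERM OF (P4) IN NUMBERS.**  On the `θ`-small dressing box (`lo = z₀ − (3R+2)`, `hi = z₀ + (3R+4)`, `hi ≤ lo + n`, `n < sitesPerDir`,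
`4·(d−1)nθ ≤ 1`), for `βt` antisymmetric with cube derivative `γt`, the cutoff `χ` and the antisymmetrised Pauli read-out `F̂^α` of `V = U^{axialGauge}`:
`|Σ_{Q_{3R+2}}ΣΣΣ(χγt)·(F̂^α(·+e_κ) − F̂^α)| ≤ 1312·((d−1)nθ)²·((81∕2)·(K₀ + 26C₁(3R+ℓ0))·M₀)`. [cite: GrossCMP1983, Thm 2.2] -/
theorem bianchi_abs_le (U : GaugeField (F.P K) 0 (Matrix.specialUnitaryGroup (Fin 2) ℂ)) {lo hi : Fin (F.P K).d → ℤ} {θ : ℝ} {n : ℕ}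
    (hU : PlaqSmallOn (boxPlaqs lo hi) θ U) (hθ : 0 ≤ θ) (hn : ∀ κ, hi κ ≤ lo κ + n) (hnN : n < (F.P K).sitesPerDir 0)
    (hsmall4 : 4 * ((((F.P K).d - 1 : ℕ) : ℝ) * n * θ) ≤ 1)
    (hlo : ∀ κ, lo κ = z₀ κ - (3 * (R : ℤ) + 2)) (hhi : ∀ κ, hi κ = z₀ κ + (3 * (R : ℤ) + 4))
    (hβanti : ∀ x μ ν, βt x ν μ = -βt x μ ν)
    (α : Fin 3) (Fh : Zd (F.P K).d → Fin (F.P K).d → Fin (F.P K).d → ℝ)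
    (hFh : ∀ y (μ ν : Fin (F.P K).d) (h : μ < ν), Fh y μ ν =
      ((I • pauli α) * (((GaugeField.plaqHol (GaugeField.gaugeAct (axialGauge U lo hi) U) ⟨castSite y, μ, ν, h⟩ :
        Matrix.specialUnitaryGroup (Fin 2) ℂ) : Matrix (Fin 2) (Fin 2) ℂ) - 1)).trace.re)
    (hFha : ∀ y μ ν, Fh y ν μ = -Fh y μ ν) :
    |∑ y ∈ box z₀ (3 * (R : ℤ) + 2), ∑ κ, ∑ μ, ∑ ν, (χ y * γt y κ μ ν) * (Fh (y + unitVec κ) μ ν - Fh y μ ν)|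
      ≤ 1312 * ((((F.P K).d - 1 : ℕ) : ℝ) * n * θ) ^ 2 *
          ((81 / 2) * ((∑ e' : Fin 3, |latticeGreen (unitVec e') - latticeGreen (0 : Zd 3)|) + 26 * C₁ * (((3 * R : ℕ) : ℝ) + ℓ0))
            * ∑ μ, ∑ ν, ∑ y ∈ box z₀ (ℓ0 : ℤ), |wt y μ ν|) := by
  have e3R : ((3 * R : ℕ) : ℤ) = 3 * (R : ℤ) := by push_cast; ring
  have hbulk := CovariantDischargeGreenPotentialShell.bulk_mass_le hC₁ hK1 wt βt γt z₀ ℓ0 (3 * R) hβt hγt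
  rw [e3R] at hbulk
  exact GrossTransferStubLinTestBianchiTerm.bianchi_term_le_of_letters_of_mass U hU hθ hn hnN hsmall4 z₀ R hlo hhi βt γt χ hβanti hγt hχ01 hχ0
    hbulk α Fh hFh hFha

/-! ## §3 The `ℓ¹` mass of the collar 2-form -/

omit hC₁ hK1 hβt hat hγt hχ0 in
/-- Unit-shift re-indexing on boxes: for `f ≥ 0` and `|v_i| ≤ 1`, `Σ_{x∈Q_S(z₀)} f(x+v) ≤ Σ_{x∈Q_{S+1}(z₀)} f(x)`. [folklore] -/
theorem sum_box_shift_le (f : Zd (F.P K).d → ℝ) (hf : ∀ x, 0 ≤ f x) (v : Zd (F.P K).d) (hv : ∀ i, |v i| ≤ 1) (S : ℤ) :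
    ∑ x ∈ box z₀ S, f (x + v) ≤ ∑ x ∈ box z₀ (S + 1), f x := by
  rw [← Finset.sum_image (f := f) (s := box z₀ S) (g := fun x => x + v) (fun x _ y _ h => add_right_cancel h)]
  refine Finset.sum_le_sum_of_subset_of_nonneg ?_ (fun x _ _ => hf x)
  intro w hw
  rw [Finset.mem_image] at hw
  obtain ⟨x, hx, rfl⟩ := hw
  rw [mem_box] at hx ⊢
  intro i
  have h1 := hx i
  have h2 := hv i
  have e1 : (x + v) i - z₀ i = (x i - z₀ i) + v i := by simp only [Pi.add_apply]; ring
  rw [e1]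
  exact (abs_add_le _ _).trans (by linarith only [h1, h2])

include hC₁ hK1 hβt hat hγt hχ01 in
/-- ★★ **THE `ℓ¹` MASS OF `σ = E₁ − C₂` ON `Q_{3R+2}(z₀)`**: with `|χ − χ| ≤ 1`, `|E₁(x,μ,ν)| ≤ |at'(x+e_μ,ν)| + |at'(x+e_ν,μ)|` and `|C₂(x,μ,ν)| ≤ Σ_κ|γt(x−e_κ,κ,μ,ν)|`,
so after unit shifts `Σ_{Q_{3R+2}}ΣΣ|σ| ≤ 6·Σ_{Q_{3R+3}}Σ_ν|at'| + Σ_{Q_{3R+3}}ΣΣΣ|γt|`, and the two masses are ✓`near_mass_le`∕✓`bulk_mass_le` at `S = 3R+3`.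
[cite: Balaban1984PropagatorsII, (1.9) p.226] -/
theorem sigma_abs_mass_le (E1 C2 σ : Zd (F.P K).d → Fin (F.P K).d → Fin (F.P K).d → ℝ)
    (hE1 : ∀ x μ ν, E1 x μ ν = (χ (x + unitVec μ) - χ x) * at' (x + unitVec μ) ν - (χ (x + unitVec ν) - χ x) * at' (x + unitVec ν) μ)
    (hC2 : ∀ x μ ν, C2 x μ ν = ∑ κ, (χ x - χ (x - unitVec κ)) * γt (x - unitVec κ) κ μ ν)
    (hσ : ∀ x μ ν, σ x μ ν = E1 x μ ν - C2 x μ ν) :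
    ∑ y ∈ box z₀ (3 * (R : ℤ) + 2), ∑ μ, ∑ ν, |σ y μ ν|
      ≤ 6 * ((9 / 2) * ((∑ e' : Fin 3, |latticeGreen (unitVec e') - latticeGreen (0 : Zd 3)|) + 26 * C₁ * (((3 * R + 3 : ℕ) : ℝ) + 1 + ℓ0))
              * ∑ μ, ∑ ν, ∑ y ∈ box z₀ (ℓ0 : ℤ), |wt y μ ν|)
        + (81 / 2) * ((∑ e' : Fin 3, |latticeGreen (unitVec e') - latticeGreen (0 : Zd 3)|) + 26 * C₁ * (((3 * R + 3 : ℕ) : ℝ) + ℓ0))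
            * ∑ μ, ∑ ν, ∑ y ∈ box z₀ (ℓ0 : ℤ), |wt y μ ν| := by
  have hd : (F.P K).d = 3 := rfl
  have e3R3 : ((3 * R + 3 : ℕ) : ℤ) = 3 * (R : ℤ) + 2 + 1 := by push_cast; ring
  have hnear3 := CovariantDischargeGreenPotentialShell.near_mass_le hC₁ hK1 wt βt at' z₀ ℓ0 (3 * R + 3) hβt hat
  rw [e3R3] at hnear3
  have hbulk3 := CovariantDischargeGreenPotentialShell.bulk_mass_le hC₁ hK1 wt βt γt z₀ ℓ0 (3 * R + 3) hβt hγt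
  rw [e3R3] at hbulk3
  have hχdiff : ∀ x x' : Zd (F.P K).d, |χ x - χ x'| ≤ 1 := by
    intro x x'
    have h1 := hχ01 x
    have h2 := hχ01 x'
    rw [abs_le]; constructor <;> linarith only [h1.1, h1.2, h2.1, h2.2]
  have hE1abs : ∀ x μ ν, |E1 x μ ν| ≤ |at' (x + unitVec μ) ν| + |at' (x + unitVec ν) μ| := by
    intro x μ ν
    rw [hE1]
    refine (abs_sub _ _).trans ?_
    rw [abs_mul, abs_mul]
    have ha := abs_nonneg (at' (x + unitVec μ) ν)
    have hb := abs_nonneg (at' (x + unitVec ν) μ)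
    nlinarith only [hχdiff (x + unitVec μ) x, hχdiff (x + unitVec ν) x, ha, hb]
  have hC2abs : ∀ x μ ν, |C2 x μ ν| ≤ ∑ κ, |γt (x - unitVec κ) κ μ ν| := by
    intro x μ ν
    rw [hC2]
    refine (Finset.abs_sum_le_sum_abs _ _).trans (Finset.sum_le_sum fun κ _ => ?_)
    rw [abs_mul]
    have hg := abs_nonneg (γt (x - unitVec κ) κ μ ν)
    nlinarith only [hχdiff x (x - unitVec κ), hg]
  have hunit_le : ∀ (κ : Fin (F.P K).d) (i : Fin (F.P K).d), |(unitVec κ : Zd (F.P K).d) i| ≤ 1 := fun κ i => abs_unitVec_apply_le κ i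
  have hnegunit_le : ∀ (κ : Fin (F.P K).d) (i : Fin (F.P K).d), |(-unitVec κ : Zd (F.P K).d) i| ≤ 1 := fun κ i => by
    rw [Pi.neg_apply, abs_neg]; exact abs_unitVec_apply_le κ i
  -- `Σ|σ| ≤ Σ|E1| + Σ|C2|`
  have h1 : ∑ y ∈ box z₀ (3 * (R : ℤ) + 2), ∑ μ, ∑ ν, |σ y μ ν|
      ≤ ∑ y ∈ box z₀ (3 * (R : ℤ) + 2), ∑ μ, ∑ ν, (|at' (y + unitVec μ) ν| + |at' (y + unitVec ν) μ|)
        + ∑ y ∈ box z₀ (3 * (R : ℤ) + 2), ∑ μ, ∑ ν, ∑ κ, |γt (y - unitVec κ) κ μ ν| := by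
    rw [← Finset.sum_add_distrib]
    refine Finset.sum_le_sum fun y _ => ?_
    rw [← Finset.sum_add_distrib]
    refine Finset.sum_le_sum fun μ _ => ?_
    rw [← Finset.sum_add_distrib]
    refine Finset.sum_le_sum fun ν _ => ?_
    rw [hσ]
    exact (abs_sub _ _).trans (add_le_add (hE1abs y μ ν) (hC2abs y μ ν))
  -- the `E1` part
  have hA : ∀ μ : Fin (F.P K).d, ∑ y ∈ box z₀ (3 * (R : ℤ) + 2), ∑ ν, |at' (y + unitVec μ) ν| ≤ ∑ y ∈ box z₀ (3 * (R : ℤ) + 2 + 1), ∑ ν, |at' y ν| :=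
    fun μ => sum_box_shift_le F K z₀ (fun y => ∑ ν, |at' y ν|) (fun y => Finset.sum_nonneg fun _ _ => abs_nonneg _) (unitVec μ) (hunit_le μ) _
  have hE1part : ∑ y ∈ box z₀ (3 * (R : ℤ) + 2), ∑ μ, ∑ ν, (|at' (y + unitVec μ) ν| + |at' (y + unitVec ν) μ|)
      ≤ 2 * (3 * ∑ y ∈ box z₀ (3 * (R : ℤ) + 2 + 1), ∑ ν, |at' y ν|) := by
    have hsym : ∑ y ∈ box z₀ (3 * (R : ℤ) + 2), ∑ μ, ∑ ν, |at' (y + unitVec ν) μ| = ∑ y ∈ box z₀ (3 * (R : ℤ) + 2), ∑ μ, ∑ ν, |at' (y + unitVec μ) ν| :=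
      Finset.sum_congr rfl fun y _ => Finset.sum_comm
    have hcomm : ∑ y ∈ box z₀ (3 * (R : ℤ) + 2), ∑ μ, ∑ ν, |at' (y + unitVec μ) ν| = ∑ μ, ∑ y ∈ box z₀ (3 * (R : ℤ) + 2), ∑ ν, |at' (y + unitVec μ) ν| :=
      Finset.sum_comm
    have h3 : ∑ μ : Fin (F.P K).d, ∑ y ∈ box z₀ (3 * (R : ℤ) + 2), ∑ ν, |at' (y + unitVec μ) ν| ≤ 3 * ∑ y ∈ box z₀ (3 * (R : ℤ) + 2 + 1), ∑ ν, |at' y ν| := by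
      calc ∑ μ : Fin (F.P K).d, ∑ y ∈ box z₀ (3 * (R : ℤ) + 2), ∑ ν, |at' (y + unitVec μ) ν|
          ≤ ∑ _μ : Fin (F.P K).d, ∑ y ∈ box z₀ (3 * (R : ℤ) + 2 + 1), ∑ ν, |at' y ν| := Finset.sum_le_sum fun μ _ => hA μ
        _ = 3 * ∑ y ∈ box z₀ (3 * (R : ℤ) + 2 + 1), ∑ ν, |at' y ν| := by
            have hd3r : (((F.P K).d : ℕ) : ℝ) = 3 := by rw [hd]; norm_num
            rw [Finset.sum_const, Finset.card_univ, Fintype.card_fin, nsmul_eq_mul, hd3r]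
    rw [Finset.sum_congr rfl fun y _ => by rw [Finset.sum_congr rfl fun μ _ => Finset.sum_add_distrib, Finset.sum_add_distrib], Finset.sum_add_distrib,
      hsym, hcomm]
    linarith only [h3]
  -- the `C2` part
  have hC2part : ∑ y ∈ box z₀ (3 * (R : ℤ) + 2), ∑ μ, ∑ ν, ∑ κ, |γt (y - unitVec κ) κ μ ν|
      ≤ ∑ y ∈ box z₀ (3 * (R : ℤ) + 2 + 1), ∑ κ, ∑ μ, ∑ ν, |γt y κ μ ν| := by
    have hB : ∀ κ : Fin (F.P K).d, ∑ y ∈ box z₀ (3 * (R : ℤ) + 2), ∑ μ, ∑ ν, |γt (y - unitVec κ) κ μ ν| ≤ ∑ y ∈ box z₀ (3 * (R : ℤ) + 2 + 1), ∑ μ, ∑ ν, |γt y κ μ ν| := by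
      intro κ
      have h := sum_box_shift_le F K z₀ (fun y => ∑ μ, ∑ ν, |γt y κ μ ν|) (fun y => Finset.sum_nonneg fun _ _ => Finset.sum_nonneg fun _ _ => abs_nonneg _)
        (-unitVec κ) (hnegunit_le κ) (3 * (R : ℤ) + 2)
      simpa only [← sub_eq_add_neg] using h
    have hre : ∀ y, ∑ μ, ∑ ν, ∑ κ, |γt (y - unitVec κ) κ μ ν| = ∑ κ, ∑ μ, ∑ ν, |γt (y - unitVec κ) κ μ ν| := by
      intro y
      have h1 : ∀ μ : Fin (F.P K).d, ∑ ν, ∑ κ, |γt (y - unitVec κ) κ μ ν| = ∑ κ, ∑ ν, |γt (y - unitVec κ) κ μ ν| := fun μ => Finset.sum_comm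
      simp only [h1]
      exact Finset.sum_comm
    calc ∑ y ∈ box z₀ (3 * (R : ℤ) + 2), ∑ μ, ∑ ν, ∑ κ, |γt (y - unitVec κ) κ μ ν|
        = ∑ κ, ∑ y ∈ box z₀ (3 * (R : ℤ) + 2), ∑ μ, ∑ ν, |γt (y - unitVec κ) κ μ ν| := by
          rw [Finset.sum_congr rfl fun y _ => hre y]; exact Finset.sum_comm
      _ ≤ ∑ κ, ∑ y ∈ box z₀ (3 * (R : ℤ) + 2 + 1), ∑ μ, ∑ ν, |γt y κ μ ν| := Finset.sum_le_sum fun κ _ => hB κ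
      _ = ∑ y ∈ box z₀ (3 * (R : ℤ) + 2 + 1), ∑ κ, ∑ μ, ∑ ν, |γt y κ μ ν| := Finset.sum_comm
  -- the (Z-e) rows, read over `Fin (F.P K).d` (`rfl`) so that `linarith` sees one atom
  have hnear3' : ∑ y ∈ box z₀ (3 * (R : ℤ) + 2 + 1), ∑ ν : Fin (F.P K).d, |at' y ν|
      ≤ (9 / 2) * ((∑ e' : Fin 3, |latticeGreen (unitVec e') - latticeGreen (0 : Zd 3)|) + 26 * C₁ * (((3 * R + 3 : ℕ) : ℝ) + 1 + ℓ0))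
          * ∑ μ : Fin (F.P K).d, ∑ ν : Fin (F.P K).d, ∑ y ∈ box z₀ (ℓ0 : ℤ), |wt y μ ν| := hnear3
  have hbulk3' : ∑ y ∈ box z₀ (3 * (R : ℤ) + 2 + 1), ∑ κ : Fin (F.P K).d, ∑ μ : Fin (F.P K).d, ∑ ν : Fin (F.P K).d, |γt y κ μ ν|
      ≤ (81 / 2) * ((∑ e' : Fin 3, |latticeGreen (unitVec e') - latticeGreen (0 : Zd 3)|) + 26 * C₁ * (((3 * R + 3 : ℕ) : ℝ) + ℓ0))
          * ∑ μ : Fin (F.P K).d, ∑ ν : Fin (F.P K).d, ∑ y ∈ box z₀ (ℓ0 : ℤ), |wt y μ ν| := hbulk3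
  linarith only [h1, hE1part, hC2part, hnear3', hbulk3']

end Summit.QuantumFields.YangMills.Theorems.GrossTransferStubLinTestPointwiseMasses

end
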